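import Summits.QuantumAdvantage.QuantumAdvantage.Theorems.CodimDialBasic

/-!
# CodimDial — part 2/6 «Rings» (cell decomp-qadv, seat lens-5, generation 12 rev 2; supports item 30910 `SpreadDial.PureCover3`)

§5 EMBEDDING `spreadLoss3_of_linSpread3` (the joint win event of `m ≤ n^k` rings IS an affine 𝔽₂-system on the `m·n` foreign output bits: `ringRow`, `flatQ`, `defect_ringRow`, `parity_iff`), `spreadLoss3_of_linSpreadLog3`; §6 NECESSITY from `T = RingHardOdd 3` (`linSpread3_of_ringHardOdd` and the dial below it); §7 the Lin-currency pieces `pureCover3_of_linCoverLog3`, `closes` (leaf BY NAME).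

Verbatim from the node file `run/shared/lean/pub/decomp-qadv/decomp-qadv-lens-5/g12/CodimDial.lean` (rev 2, sha256 b503e7e59b532c38…;
record `…/g12/NODE-g12.md`; critic row 74 VERIFIED/CLEARED the split), re-namespaced `…Theses.CodimDial` ↦ `…Theorems.CodimDial`;
imports part 1/6 (`CodimDialBasic`); joint check of parts 1–2 = `g12/tree/Parts1to2.check.lean` (farm rc 0 · 0 errors ·
0 warnings · 0 sorries).  The `def … : Prop` declarations are STATEMENTS OF THE NODE (regimes of the dial and the two pieces of the exact split
`PureCover3 ⟺ A ∧ B`), not new cruxes; the pieces to FILE are `FewCover3` / `FewBridge3` (part 6) or equivalently `LinCoverLogMed3` / `MedBridge3` (part 5).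
NODE EQUATION: `AdviceFreeQNC0Three ⟸ PolyLoss3 [26123] ∧ AlgCover3 [30909] ∧ A ∧ B`, `PureCover3 (30910) ⟺ A ∧ B` (kernel).
-/

set_option linter.style.longLine false
set_option linter.dupNamespace false

noncomputable section
open scoped Classical

namespace Summit.QuantumAdvantage.QuantumAdvantage.Theorems.CodimDial

open Finset
open Literature.Computability.QuantumComplexity Literature.Computability.QuantumComplexity.RingHLF
open Literature.Computability.MetaComplexity
open Summit.QuantumAdvantage.AdviceFreeQNC0
open Summit.QuantumAdvantage.QuantumAdvantage.Theses

/-! ## §5  Ring win events ARE affine 𝔽₂-systems: `LinSpread3 → SpreadLoss3` (the dial dominates 29064) -/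

section Embedding
variable {n : ℕ}

/-- the trivial row has defect `0`. -/
theorem defect_zero {N : ℕ} (G : Fin N → Smolensky.CubeFn (ZMod 3) n) (y : Fin n → Bool) :
    defect G 0 0 y = 0 := by
  simp [defect]

/-- the row of ring `t` and kernel vector `v` on the flattened foreign output family. -/
def ringRow {m : ℕ} (t : Fin m) (v : Fin n → Bool) : Fin (m * n) → ZMod 2 := fun u =>
  if (finProdFinEquiv.symm u).1 = t ∧ v (finProdFinEquiv.symm u).2 = true then 1 else 0

/-- the flattened foreign output family. -/
def flatQ {m : ℕ} (Q : Fin m → Fin n → Smolensky.CubeFn (ZMod 3) n) : Fin (m * n) → Smolensky.CubeFn (ZMod 3) n :=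
  fun u => Q (finProdFinEquiv.symm u).1 (finProdFinEquiv.symm u).2

/-- the defect of a ring row is the kernel parity `⟨v, z_t(y)⟩ + σ`. -/
theorem defect_ringRow {m : ℕ} (Q : Fin m → Fin n → Smolensky.CubeFn (ZMod 3) n) (t : Fin m) (v : Fin n → Bool)
    (σ : ZMod 2) (y : Fin n → Bool) :
    defect (flatQ Q) (ringRow t v) σ y = (∑ i, if v i = true then bit (Q t i) y else 0) + σ := by
  unfold defect
  congr 1
  rw [← (finProdFinEquiv : Fin m × Fin n ≃ Fin (m * n)).sum_comp]
  simp only [ringRow, flatQ, Equiv.symm_apply_apply, Fintype.sum_prod_type]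
  rw [Finset.sum_eq_single t]
  · refine Finset.sum_congr rfl fun i _ => ?_
    by_cases hv : v i = true
    · simp [hv]
    · simp [hv]
  · intro t' _ ht'
    exact Finset.sum_eq_zero fun i _ => by simp [ht']
  · intro ht; exact absurd (Finset.mem_univ t) ht

/-- the kernel parity in `𝔽₂` versus the tree's `ℕ`-valued `dot2`/`signBit`. -/
theorem parity_iff {m : ℕ} (Q : Fin m → Fin n → Smolensky.CubeFn (ZMod 3) n) (t : Fin m) (x v : Fin n → Bool)
    (y : Fin n → Bool) :
    (∑ i, if v i = true then bit (Q t i) y else 0) + ((signBit x v : ℕ) : ZMod 2) = 0 ↔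
      dot2 v (fun i => decide (Q t i y = 1)) = signBit x v := by
  have hsum : (∑ i, if v i = true then bit (Q t i) y else 0 : ZMod 2) =
      ((univ.filter fun i : Fin n => v i = true ∧ decide (Q t i y = 1) = true).card : ZMod 2) := by
    rw [Finset.natCast_card_filter]
    refine Finset.sum_congr rfl fun i _ => ?_
    by_cases hv : v i = true
    · by_cases hq : Q t i y = 1
      · simp [bit, hv, hq]
      · simp [bit, hv, hq]
    · simp [hv]
  rw [hsum, ← Nat.cast_add, ZMod.natCast_eq_zero_iff]
  unfold dot2
  show 2 ∣ ((univ.filter fun i : Fin n => v i = true ∧ decide (Q t i y = 1) = true).card + signBit x v) ↔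
      (univ.filter fun i : Fin n => v i = true ∧ decide (Q t i y = 1) = true).card % 2 = signBit x v
  have hs : signBit x v < 2 := by unfold signBit; exact Nat.mod_lt _ (by norm_num)
  constructor
  · intro h; omega
  · intro h; omega

/-- **Embedding theorem**: `LinSpread3 → SpreadDial.SpreadLoss3` — the joint win event of `m ≤ n^k` foreign rings is
the event of the affine `𝔽₂`-system with one row per (ring, kernel vector) (off-kernel rows trivial) on the `m·n ≤
n^(k+1)` flattened foreign output bits. -/
theorem spreadLoss3_of_linSpread3 (h : LinSpread3) : SpreadDial.SpreadLoss3 := by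
  obtain ⟨η, hη, k, hk⟩ := h
  refine ⟨η, hη, k, fun c => ?_⟩
  obtain ⟨n₀, hn₀⟩ := hk (k + 1) c
  refine ⟨n₀, fun n hn P hP m hm w Q hQ hdense => ?_⟩
  -- the bit family and the system
  have hG : ∀ u, flatQ Q u ∈ Smolensky.lowDeg (ZMod 3) n ((Nat.log 2 n) ^ c) := fun u => hQ _ _
  have hN : m * n ≤ n ^ (k + 1) := by rw [pow_succ]; exact Nat.mul_le_mul_right n hm
  have hcardB : Fintype.card (Fin n → Bool) = 2 ^ n := by simp
  let eB : (Fin n → Bool) ≃ Fin (2 ^ n) := Fintype.equivFinOfCardEq hcardB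
  let eJ : Fin m × (Fin n → Bool) ≃ Fin (m * 2 ^ n) :=
    (Equiv.prodCongr (Equiv.refl (Fin m)) eB).trans finProdFinEquiv
  let A : Fin (m * 2 ^ n) → Fin (m * n) → ZMod 2 := fun r =>
    if InKernel (w (eJ.symm r).1) (eJ.symm r).2 then ringRow (eJ.symm r).1 (eJ.symm r).2 else 0
  let b : Fin (m * 2 ^ n) → ZMod 2 := fun r =>
    if InKernel (w (eJ.symm r).1) (eJ.symm r).2 then ((signBit (w (eJ.symm r).1) (eJ.symm r).2 : ℕ) : ZMod 2) else 0
  -- one row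
  have hrow : ∀ (t : Fin m) (v : Fin n → Bool) (y : Fin n → Bool),
      defect (flatQ Q) (A (eJ (t, v))) (b (eJ (t, v))) y = 0 ↔
        (InKernel (w t) v → dot2 v (fun i => decide (Q t i y = 1)) = signBit (w t) v) := by
    intro t v y
    by_cases hK : InKernel (w t) v
    · simp only [A, b, Equiv.symm_apply_apply, hK, if_true, forall_true_left]
      rw [defect_ringRow, parity_iff]
    · simp only [A, b, Equiv.symm_apply_apply, hK, if_false, IsEmpty.forall_iff, iff_true]
      exact defect_zero _ y
  -- all rows
  have hkey : ∀ y : Fin n → Bool, (∀ r, defect (flatQ Q) (A r) (b r) y = 0) ↔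
      ∀ t, RingHLF.Rel (w t) (fun i => decide (Q t i y = 1)) := by
    intro y
    constructor
    · intro hall t v hv
      exact (hrow t v y).mp (hall (eJ (t, v))) hv
    · intro hrel r
      have := (hrow (eJ.symm r).1 (eJ.symm r).2 y).mpr (hrel _ _)
      simpa only [Prod.mk.eta, Equiv.apply_symm_apply] using this
  -- transport density and the conclusion at membership level
  have hdense' : (1 - η) * (2 : ℝ) ^ n ≤ ((linEvent (flatQ Q) A b).card : ℝ) := by
    refine le_trans hdense ?_
    exact_mod_cast card_le_card fun y hy => by
      simp only [Finset.mem_filter, Finset.mem_univ, true_and] at hy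
      simp only [linEvent, Finset.mem_filter, Finset.mem_univ, true_and]
      exact (hkey y).mpr hy
  have hmain := hn₀ n hn P hP (m * n) hN (flatQ Q) hG (m * 2 ^ n) A b hdense'
  refine le_trans hmain ?_
  exact_mod_cast card_le_card fun y hy => by
    rw [Finset.mem_inter] at hy
    simp only [linEvent, lossSet, Finset.mem_filter, Finset.mem_univ, true_and] at hy
    simp only [Finset.mem_filter, Finset.mem_univ, true_and]
    exact ⟨(hkey y).mp hy.1, hy.2⟩

/-- hence the logarithmic statement already decides 29064. -/
theorem spreadLoss3_of_linSpreadLog3 (h : LinSpreadLog3) : SpreadDial.SpreadLoss3 :=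
  spreadLoss3_of_linSpread3 (linSpread3_of_linSpreadLog3 h)

end Embedding

/-! ## §6  Necessity: `T ⟹` every statement of the dial (a constant loss rate meets every dense set) -/

section Necessity

/-- under `RingHard 3` (constant loss rate `1-θ` on all inputs) every set of density `≥ 1-(1-θ)/2` carries
`≥ 2ⁿ/n` losses, whatever its structure. -/
theorem denseLoss_of_ringHard (h : RingHard 3) :
    ∃ η : ℝ, 0 < η ∧ ∀ c : ℕ, ∃ n₀ : ℕ, ∀ n ≥ n₀, ∀ P : Fin n → Smolensky.CubeFn (ZMod 3) n,
      (∀ i, P i ∈ Smolensky.lowDeg (ZMod 3) n ((Nat.log 2 n) ^ c)) →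
      ∀ E : Finset (Fin n → Bool), (1 - η) * (2 : ℝ) ^ n ≤ (E.card : ℝ) →
        1 / (n : ℝ) ^ 1 * (2 : ℝ) ^ n ≤ ((E ∩ lossSet P).card : ℝ) := by
  obtain ⟨θ, hθ, hc⟩ := h
  refine ⟨(1 - θ) / 2, by linarith, fun c => ?_⟩
  obtain ⟨n₀, hn₀⟩ := hc c
  obtain ⟨Nn, hNn⟩ := exists_nat_gt (2 / (1 - θ))
  refine ⟨max n₀ (max Nn 1), fun n hn P hP E hdense => ?_⟩
  have hnn₀ : n₀ ≤ n := le_of_max_le_left hn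
  have hnN : Nn ≤ n := le_of_max_le_left (le_of_max_le_right hn)
  have hn1 : 1 ≤ n := le_of_max_le_right (le_of_max_le_right hn)
  have hpos : 0 < 1 - θ := by linarith
  have hwin := hn₀ n hnn₀ P hP
  -- the wins inside `E` are at most all wins
  have hXle : ((E.filter fun y => RingHLF.Rel y (fun i => decide (P i y = 1))).card : ℝ) ≤ θ * (2 : ℝ) ^ n := by
    refine le_trans ?_ hwin
    exact_mod_cast card_le_card fun y hy => by
      rw [Finset.mem_filter] at hy
      simp only [Finset.mem_filter, Finset.mem_univ, true_and]
      exact hy.2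
  -- `E` splits into wins and losses
  have hsplit : ((E.filter fun y => RingHLF.Rel y (fun i => decide (P i y = 1))).card : ℝ) +
      ((E ∩ lossSet P).card : ℝ) = (E.card : ℝ) := by
    have h1 := Finset.card_filter_add_card_filter_not (s := E)
      (fun y : Fin n → Bool => RingHLF.Rel y (fun i => decide (P i y = 1)))
    have h2 : (E.filter fun y => ¬ RingHLF.Rel y (fun i => decide (P i y = 1))) = E ∩ lossSet P := by
      ext y
      simp only [lossSet, Finset.mem_filter, Finset.mem_inter, Finset.mem_univ, true_and]
    rw [h2] at h1
    exact_mod_cast h1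
  have hnR : (2 : ℝ) / (1 - θ) < n := lt_of_lt_of_le hNn (by exact_mod_cast hnN)
  have hinv : 1 / (n : ℝ) ^ 1 ≤ (1 - θ) / 2 := by
    rw [pow_one, div_le_div_iff₀ (by exact_mod_cast (show 0 < n by omega)) (by norm_num)]
    have := (div_lt_iff₀ hpos).mp hnR
    linarith
  have h2n : (0 : ℝ) < (2 : ℝ) ^ n := by positivity
  calc 1 / (n : ℝ) ^ 1 * (2 : ℝ) ^ n ≤ (1 - θ) / 2 * (2 : ℝ) ^ n := mul_le_mul_of_nonneg_right hinv h2n.le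
    _ ≤ _ := by nlinarith

/-- `RingHard 3 → LinSpread3`. -/
theorem linSpread3_of_ringHard (h : RingHard 3) : LinSpread3 := by
  obtain ⟨η, hη, hmain⟩ := denseLoss_of_ringHard h
  refine ⟨η, hη, 1, fun C c => ?_⟩
  obtain ⟨n₀, hn₀⟩ := hmain c
  exact ⟨n₀, fun n hn P hP N _ G _ ℓ A b hd => hn₀ n hn P hP _ hd⟩

/-- **necessity for T**: `RingHardOdd 3 → LinSpread3` (give away the even class: tree `ringHardOfOdd`). -/
theorem linSpread3_of_ringHardOdd (h : RingHardOdd 3) : LinSpread3 :=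
  linSpread3_of_ringHard (ringHardOfOdd 3 h)

/-- CodimDialRings helper `linSpreadLog3_of_ringHardOdd` (decomp-qadv land package; see the module docstring). -/
theorem linSpreadLog3_of_ringHardOdd (h : RingHardOdd 3) : LinSpreadLog3 :=
  linSpreadLog3_of_linSpread3 (linSpread3_of_ringHardOdd h)

/-- CodimDialRings helper `linSpreadLight3_of_ringHardOdd` (decomp-qadv land package; see the module docstring). -/
theorem linSpreadLight3_of_ringHardOdd (h : RingHardOdd 3) : LinSpreadLight3 :=
  linSpreadLight3_of_linSpreadLog3 (linSpreadLog3_of_ringHardOdd h)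

/-- CodimDialRings helper `linSpreadOne3_of_ringHardOdd` (decomp-qadv land package; see the module docstring). -/
theorem linSpreadOne3_of_ringHardOdd (h : RingHardOdd 3) : LinSpreadOne3 :=
  linSpreadOne3_of_linSpread3 (linSpread3_of_ringHardOdd h)

end Necessity

/-! ## §7  The pieces, the order of the pieces, and the deciding theorem -/

section Node

/-- the top of the dial decides 30910: `LinCoverLog3 → PureCover3`. -/
theorem pureCover3_of_linCoverLog3 (hR : LinCoverLog3) : SpreadDial.PureCover3 :=
  fun hP hA => spreadLoss3_of_linSpreadLog3 (hR hP hA)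

/-- … and with the W-piece, the parent: `AlgCover3 → LinCoverLog3 → CoverLift3` (29065). -/
theorem coverLift3_of_pieces (hA : SpreadDial.AlgCover3) (hR : LinCoverLog3) : SpreadDial.CoverLift3 :=
  fun hP => spreadLoss3_of_linSpreadLog3 (hR hP (hA hP))

/-- necessity of the top: `RingHardOdd 3 → LinCoverLog3`. -/
theorem linCoverLog3_of_ringHardOdd (h : RingHardOdd 3) : LinCoverLog3 :=
  fun _ _ => linSpreadLog3_of_ringHardOdd h

/-- down the dial in cover form. -/
theorem linCoverLight3_of_linCoverLog3 (h : LinCoverLog3) : LinCoverLight3 :=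
  fun hP hA => linSpreadLight3_of_linSpreadLog3 (h hP hA)

/-- CodimDialRings helper `linCoverOne3_of_linCoverLog3` (decomp-qadv land package; see the module docstring). -/
theorem linCoverOne3_of_linCoverLog3 (h : LinCoverLog3) : LinCoverOne3 :=
  fun hP hA => linSpreadOne3_of_linSpreadLog3 (h hP hA)

/-- T* from the pieces (SpreadDial's hybrid bridge, landed). -/
theorem multiRingHard3_of_pieces (hP : SpreadDial.PolyLoss3) (hA : SpreadDial.AlgCover3) (hR : LinCoverLog3) :
    SpreadDial.MultiRingHard3 :=
  Theorems.spreadDial_spreadBridge3 (coverLift3_of_pieces hA hR hP)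

/-- **THE DECIDING THEOREM of the node** (conclusion = the rung leaf BY NAME):
`PolyLoss3 → AlgCover3 → LinCoverLog3 → AdviceFreeQNC0Three`. -/
theorem closes (hP : SpreadDial.PolyLoss3) (hA : SpreadDial.AlgCover3) (hR : LinCoverLog3) :
    AdviceFreeQNC0Three :=
  Theorems.spreadDial_closes₂ hP (coverLift3_of_pieces hA hR)

/-- the same through the tree's own `SpreadDial.closes` junction (bridges discharged by the landed theorems). -/
theorem closes_tree (hP : SpreadDial.PolyLoss3) (hA : SpreadDial.AlgCover3) (hR : LinCoverLog3) :
    AdviceFreeQNC0Three :=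
  SpreadDial.closes hP (coverLift3_of_pieces hA hR) Theorems.spreadDial_spreadBridge3 Theorems.spreadDial_multiRingBridge3

end Node

end Summit.QuantumAdvantage.QuantumAdvantage.Theorems.CodimDial
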